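import Mathlib
import HarnessLib

/-!
# Stalks of schemes locally of finite type over a field are quotients of local rings of affine space

Route `FrobeniusLadder`, crux `FRationalResolution` (stmt-ResolutionOfSingularities-15317), line
`Sketch`; by-product program "F-rational ⇒ Cohen–Macaulay" (Hochster–Huneke 1994, Thm. 4.2 (c))
for the stalks of `k`-schemes locally of finite type, which runs colon capturing in a presentation
`𝒪_{X,x} ≅ S ⧸ Q` with `S` a regular local ring. This file supplies the presentation (step CC6 of
the assembly): for `f : X → Spec k` locally of finite type and `x ∈ X` there are `n`, a prime ideal
`P ⊂ k[T₁, …, Tₙ]` and an ideal `Q ⊂ k[T]_P` with `𝒪_{X,x} ≃+* k[T]_P ⧸ Q`. (That `S = k[T]_P` is a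
regular local ring is Mathlib's `IsRegularRing (MvPolynomial (Fin n) k)`; that and the primality of
`Q` for domain stalks are not part of this file.)

Proof. Take an affine open neighbourhood `x ∈ U` (`exists_isAffineOpen_mem_and_subset`);
`A = Γ(X, U)` is a `k`-algebra of finite type (`Scheme.Hom.finiteType_appLE` composed with the
isomorphism `Γ(Spec k) ≅ k`, `Scheme.ΓSpecIso`), so there is a surjection `φ : k[T₁, …, Tₙ] ↠ A`
(`Algebra.FiniteType.iff_quotient_mvPolynomial''`). The stalk `𝒪_{X,x}` is the localization `A_𝔭`
at the prime `𝔭` of `A` corresponding to `x` (`IsAffineOpen.isLocalization_stalk`,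
`IsLocalization.algEquiv`), and with `P = φ⁻¹ 𝔭` the induced local homomorphism `k[T]_P → A_𝔭`
(`Localization.localRingHom`) is surjective (`RingHom.surjective_localRingHom_of_surjective`),
whence `A_𝔭 ≃ k[T]_P ⧸ ker` (`RingHom.quotientKerEquivOfSurjective`). [folklore]
-/

-- single-problem summit: the doubled namespace component is forced
set_option linter.dupNamespace false

noncomputable section

namespace Summit.ResolutionOfSingularities.ResolutionOfSingularities.Theorems.FRationalResolution

open CategoryTheory AlgebraicGeometry TopologicalSpace

/-- Affine pieces of a scheme locally of finite type over a field are finite type algebras: for an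
affine open `U` of `X`, `f : X → Spec k` locally of finite type, the ring `Γ(X, U)` is a quotient
of a polynomial ring `k[T₁, …, Tₙ]`, i.e. there is a surjective ring homomorphism
`k[T₁, …, Tₙ] ↠ Γ(X, U)`. [folklore] -/
theorem exists_stalk_ringEquiv_quotient_exists_surjective (k : Type) [Field k] (X : Scheme.{0})
    (f : X ⟶ Spec (.of k)) [LocallyOfFiniteType f] {U : X.Opens} (hU : IsAffineOpen U) :
    ∃ (n : ℕ) (φ : MvPolynomial (Fin n) k →+* Γ(X, U)), Function.Surjective φ := by
  -- `Γ(Spec k, ⊤) → Γ(X, U)` is of finite type, and `k ≅ Γ(Spec k, ⊤)`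
  have h1 : (f.appLE ⊤ U le_top).hom.FiniteType :=
    f.finiteType_appLE (isAffineOpen_top _) hU le_top
  have h2 : (Scheme.ΓSpecIso (.of k)).inv.hom.FiniteType :=
    RingHom.FiniteType.of_surjective _
      (Scheme.ΓSpecIso (.of k)).symm.commRingCatIsoToRingEquiv.surjective
  let g : k →+* Γ(X, U) := (f.appLE ⊤ U le_top).hom.comp (Scheme.ΓSpecIso (.of k)).inv.hom
  have h3 : g.FiniteType := h1.comp h2
  letI : Algebra k Γ(X, U) := g.toAlgebra
  haveI hft : Algebra.FiniteType k Γ(X, U) := RingHom.finiteType_algebraMap.mp h3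
  obtain ⟨n, φ, hφ⟩ := Algebra.FiniteType.iff_quotient_mvPolynomial''.mp hft
  exact ⟨n, φ.toRingHom, fun y => hφ y⟩

/-- **Stalks of a `k`-scheme locally of finite type are quotients of local rings of affine
spaces.** For `f : X → Spec k` locally of finite type and `x ∈ X` there are `n : ℕ`, a prime ideal
`P` of `k[T₁, …, Tₙ] = MvPolynomial (Fin n) k` and an ideal `Q` of the local ring `k[T]_P` with
`𝒪_{X,x} ≃+* k[T]_P ⧸ Q`. Concretely: `x ∈ U` affine, `φ : k[T] ↠ Γ(X, U)`, `𝔭 ↔ x`,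
`P = φ⁻¹ 𝔭`, `Q = ker (k[T]_P ↠ Γ(X, U)_𝔭 ≅ 𝒪_{X,x})`. This is the shape `R = S ⧸ Q`, `S` regular
local, in which colon capturing (Hochster–Huneke 1994, Thm. 4.2 (c): F-rational ⇒ Cohen–Macaulay)
is run. [folklore] -/
theorem exists_stalk_ringEquiv_quotient (k : Type) [Field k] (X : AlgebraicGeometry.Scheme.{0})
    (f : X ⟶ AlgebraicGeometry.Spec (.of k)) [AlgebraicGeometry.LocallyOfFiniteType f] (x : X) :
    ∃ (n : ℕ) (P : Ideal (MvPolynomial (Fin n) k)) (_ : P.IsPrime)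
      (Q : Ideal (Localization.AtPrime P)),
      Nonempty (X.presheaf.stalk x ≃+* Localization.AtPrime P ⧸ Q) := by
  -- an affine open neighbourhood `x ∈ U`, `Γ(X, U)` a quotient of `k[T₁, …, Tₙ]`
  obtain ⟨U, hU, hxU, -⟩ :=
    exists_isAffineOpen_mem_and_subset (X := X) (x := x) (U := ⊤) (Opens.mem_top x)
  obtain ⟨n, φ, hφ⟩ := exists_stalk_ringEquiv_quotient_exists_surjective k X f hU
  -- `𝒪_{X,x}` is the localization of `Γ(X, U)` at the prime `𝔭` corresponding to `x`
  letI : Algebra Γ(X, U) (X.presheaf.stalk x) :=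
    TopCat.Presheaf.algebra_section_stalk X.presheaf (⟨x, hxU⟩ : U)
  obtain ⟨𝔭, h𝔭⟩ : ∃ 𝔭 : PrimeSpectrum Γ(X, U),
      IsLocalization.AtPrime (X.presheaf.stalk x) 𝔭.asIdeal :=
    ⟨hU.primeIdealOf ⟨x, hxU⟩, hU.isLocalization_stalk ⟨x, hxU⟩⟩
  haveI := h𝔭
  let e₁ : X.presheaf.stalk x ≃+* Localization.AtPrime 𝔭.asIdeal :=
    (IsLocalization.algEquiv 𝔭.asIdeal.primeCompl (X.presheaf.stalk x)
      (Localization.AtPrime 𝔭.asIdeal)).toRingEquiv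
  -- `k[T]_P ↠ Γ(X, U)_𝔭` for `P = φ⁻¹ 𝔭`, so `Γ(X, U)_𝔭 ≅ k[T]_P ⧸ ker`
  have hsurj := RingHom.surjective_localRingHom_of_surjective φ hφ 𝔭.asIdeal
  exact ⟨n, 𝔭.asIdeal.comap φ, inferInstance,
    RingHom.ker (Localization.localRingHom (𝔭.asIdeal.comap φ) 𝔭.asIdeal φ rfl),
    ⟨e₁.trans (RingHom.quotientKerEquivOfSurjective hsurj).symm⟩⟩

end Summit.ResolutionOfSingularities.ResolutionOfSingularities.Theorems.FRationalResolution

end
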